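import Summits.CriticalPhenomena.Ising3DConformalLimit.Theses.PrecisionLaplacian
import HarnessLib

/-!
# Slab functional limit — auxiliary file: dyadic tail bound and slab regrouping

Helper file for stub `stub_slabFunctionalLimit` of line `self-energy-pick-inversion`, crux
`PrecisionLaplacian.DirectCorrelationStableTail` (stmt-CriticalPhenomena-4799).  Pure theorem file,
Ising-free.

* `norm_intCast_div_eq` : the sup norm of a rescaled lattice point, `‖x / R‖ = ‖x‖ / R`;
* `tsum_tail_eq_sum_shells`, `tsum_tail_le_of_shell_le` : a lattice tail sum `Σ_{‖x‖ > R} a(x)` is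
  the telescoping sum of its dyadic shells, so shell bounds `Σ_{R < ‖x‖ ≤ 2R} a ≤ B R^{-α}` give the
  tail bound `Σ_{‖x‖ > R} a ≤ B (1 - 2^{-α})⁻¹ R^{-α}`;
* `stub_slabFunctionalLimit_auxTail` (registered sub-goal): for a summable `a : ℤ³ → ℝ`, nonnegative
  off the origin, whose rescaled sums `R^α Σ_x a(x) f(x/R)` converge for every test function
  `f ∈ C_c(ℝ³ ∖ 0)`, the tails decay at the stable rate `Σ_{‖x‖ > R} a(x) ≤ C R^{-α}` (`R ∈ ℕ`,
  `R ≥ 1`): one shell test function `f₀ ≥ 1_{1 ≤ ‖u‖ ≤ 2}` bounds the dyadic shells;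
* `tsum_mul_eq_two_mul_tsum_slab` : slab regrouping of an even summable lattice function against an
  even bounded weight vanishing at `0`: `Σ_x a(x) h(x_i) = 2 Σ_{n ≥ 0} S⁽ⁱ⁾(n) h(n)` with the slab sums
  `S⁽ⁱ⁾(n) = Σ_{y ∈ ℤ²} a(ins_i(n, y))`.
-/

noncomputable section

namespace Summit.CriticalPhenomena.Ising3DConformalLimit.Cruxes.DirectCorrelationStableTail.SelfEnergyPickInversion

open Filter Topology MeasureTheory Literature.Probability.LatticeModels
open scoped BigOperators

/-! ### The sup norm of rescaled lattice points -/

/-- Casting a lattice point of `ℤ³` to `ℝ³` preserves the sup norm. [folklore] -/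
theorem norm_intCast_eq (x : Site 3) : ‖(fun j => (x j : ℝ))‖ = ‖x‖ := by
  apply le_antisymm
  · refine (pi_norm_le_iff_of_nonneg (norm_nonneg _)).2 fun j => ?_
    rw [Int.norm_cast_real]
    exact norm_le_pi_norm x j
  · refine (pi_norm_le_iff_of_nonneg (norm_nonneg _)).2 fun j => ?_
    rw [← Int.norm_cast_real]
    exact norm_le_pi_norm (fun j => (x j : ℝ)) j

/-- The sup norm of a rescaled lattice point: `‖x / R‖ = ‖x‖ / R` for `R > 0`. [folklore] -/
theorem norm_intCast_div_eq (x : Site 3) {R : ℝ} (hR : 0 < R) :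
    ‖(fun j => (x j : ℝ) / R)‖ = ‖x‖ / R := by
  have h1 : (fun j => (x j : ℝ) / R) = R⁻¹ • (fun j => (x j : ℝ)) := by
    ext j; simp [div_eq_inv_mul]
  rw [h1, norm_smul, norm_inv, Real.norm_of_nonneg hR.le, norm_intCast_eq, div_eq_inv_mul]

/-! ### Truncated lattice sums and dyadic shells -/

/-- A truncation of a summable lattice function is summable. [folklore] -/
theorem summable_ite_of_summable {a : Site 3 → ℝ} (ha : Summable a) (p : Site 3 → Prop)
    [DecidablePred p] : Summable fun x => if p x then a x else 0 :=
  Summable.of_norm_bounded ha.norm fun x => by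
    split_ifs
    · exact le_rfl
    · rw [norm_zero]; exact norm_nonneg _

/-- Splitting a tail into its first dyadic shell and the next tail (pointwise). [folklore] -/
theorem ite_tail_split {r t v : ℝ} (hr : 0 ≤ r) :
    (if r < t then v else 0) =
      (if r < t ∧ t ≤ 2 * r then v else 0) + (if 2 * r < t then v else 0) := by
  by_cases h1 : r < t
  · by_cases h2 : t ≤ 2 * r
    · rw [if_pos h1, if_pos ⟨h1, h2⟩, if_neg (not_lt.2 h2), add_zero]
    · rw [if_pos h1, if_neg (fun h => h2 h.2), if_pos (not_le.1 h2), zero_add]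
  · have h2 : ¬ 2 * r < t := fun h => h1 (by linarith)
    rw [if_neg h1, if_neg (fun h => h1 h.1), if_neg h2, add_zero]

/-- Splitting a lattice tail sum into its first dyadic shell and the next tail. [folklore] -/
theorem tsum_tail_split {a : Site 3 → ℝ} (ha : Summable a) {r : ℝ} (hr : 0 ≤ r) :
    ∑' x : Site 3, (if r < ‖x‖ then a x else 0) =
      ∑' x : Site 3, (if r < ‖x‖ ∧ ‖x‖ ≤ 2 * r then a x else 0) +
        ∑' x : Site 3, (if 2 * r < ‖x‖ then a x else 0) := by
  rw [← (summable_ite_of_summable ha _).tsum_add (summable_ite_of_summable ha _)]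
  exact tsum_congr fun x => ite_tail_split hr

/-- Dyadic telescoping of a lattice tail sum: the tail beyond `r` is the sum of the shells
`2^j r < ‖x‖ ≤ 2^{j+1} r`, `j < J`, plus the tail beyond `2^J r`. [folklore] -/
theorem tsum_tail_eq_sum_shells {a : Site 3 → ℝ} (ha : Summable a) {r : ℝ} (hr : 0 ≤ r) (J : ℕ) :
    ∑' x : Site 3, (if r < ‖x‖ then a x else 0) =
      ∑ j ∈ Finset.range J,
          ∑' x : Site 3, (if 2 ^ j * r < ‖x‖ ∧ ‖x‖ ≤ 2 * (2 ^ j * r) then a x else 0) +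
        ∑' x : Site 3, (if 2 ^ J * r < ‖x‖ then a x else 0) := by
  induction J with
  | zero => simp
  | succ J ih =>
    rw [ih, Finset.sum_range_succ, tsum_tail_split ha (by positivity : (0 : ℝ) ≤ 2 ^ J * r),
      pow_succ, mul_comm ((2 : ℝ) ^ J) 2, mul_assoc, add_assoc]

/-- Tails of a summable lattice function beyond thresholds tending to infinity tend to zero
(dominated convergence for sums). [folklore] -/
theorem tendsto_tsum_tail_zero {a : Site 3 → ℝ} (ha : Summable a) {r : ℕ → ℝ}
    (hr : Tendsto r atTop atTop) :
    Tendsto (fun J => ∑' x : Site 3, (if r J < ‖x‖ then a x else 0)) atTop (𝓝 0) := by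
  have h := tendsto_tsum_of_dominated_convergence (𝓕 := atTop)
    (f := fun J (x : Site 3) => if r J < ‖x‖ then a x else 0) (g := fun _ => 0)
    (bound := fun x => ‖a x‖) ha.norm ?_ ?_
  · simpa only [tsum_zero] using h
  · intro x
    refine tendsto_const_nhds.congr' ?_
    filter_upwards [hr.eventually_ge_atTop ‖x‖] with J hJ
    rw [if_neg (not_lt.2 hJ)]
  · refine Eventually.of_forall fun J x => ?_
    split_ifs
    · exact le_rfl
    · rw [norm_zero]; exact norm_nonneg _

/-- `(2^j R)^{-α} = (2^{-α})^j R^{-α}` for `R ≥ 0`. [folklore] -/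
theorem two_pow_mul_rpow_neg (j : ℕ) {R : ℝ} (α : ℝ) (hR : 0 ≤ R) :
    ((2 : ℝ) ^ j * R) ^ (-α) = ((2 : ℝ) ^ (-α)) ^ j * R ^ (-α) := by
  rw [Real.mul_rpow (by positivity) hR]
  congr 1
  rw [← Real.rpow_natCast, ← Real.rpow_natCast, ← Real.rpow_mul (by norm_num : (0 : ℝ) ≤ 2),
    ← Real.rpow_mul (by norm_num : (0 : ℝ) ≤ 2), mul_comm]

/-- **Dyadic tail bound.** If the dyadic shells of a summable lattice function satisfy
`Σ_{R < ‖x‖ ≤ 2R} a(x) ≤ B R^{-α}` for all `R ∈ ℕ`, `R ≥ 1` (`B ≥ 0`, `α > 0`), then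
`Σ_{‖x‖ > R} a(x) ≤ B (1 - 2^{-α})⁻¹ R^{-α}` for all `R ∈ ℕ`, `R ≥ 1`. [folklore] -/
theorem tsum_tail_le_of_shell_le {a : Site 3 → ℝ} (ha : Summable a) {α B : ℝ} (hα : 0 < α)
    (hB : 0 ≤ B)
    (hshell : ∀ R : ℕ, 1 ≤ R →
      ∑' x : Site 3, (if (R : ℝ) < ‖x‖ ∧ ‖x‖ ≤ 2 * (R : ℝ) then a x else 0) ≤ B * (R : ℝ) ^ (-α))
    (R : ℕ) (hR : 1 ≤ R) :
    ∑' x : Site 3, (if (R : ℝ) < ‖x‖ then a x else 0) ≤ B / (1 - 2 ^ (-α)) * (R : ℝ) ^ (-α) := by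
  set q : ℝ := (2 : ℝ) ^ (-α) with hq
  have hq0 : 0 ≤ q := by positivity
  have hq1 : q < 1 := Real.rpow_lt_one_of_one_lt_of_neg (by norm_num) (by linarith)
  have hRpos : (0 : ℝ) < R := by exact_mod_cast hR
  -- each dyadic shell
  have hsh : ∀ j : ℕ,
      ∑' x : Site 3, (if 2 ^ j * (R : ℝ) < ‖x‖ ∧ ‖x‖ ≤ 2 * (2 ^ j * (R : ℝ)) then a x else 0)
        ≤ B * (R : ℝ) ^ (-α) * q ^ j := by
    intro j
    have h := hshell (2 ^ j * R) (one_le_mul_of_one_le_of_one_le Nat.one_le_two_pow hR)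
    push_cast at h
    calc _ ≤ B * ((2 : ℝ) ^ j * R) ^ (-α) := h
      _ = B * (R : ℝ) ^ (-α) * q ^ j := by rw [two_pow_mul_rpow_neg j α hRpos.le, hq]; ring
  -- the partial sums of the shells
  have hJ : ∀ J : ℕ, ∑' x : Site 3, (if (R : ℝ) < ‖x‖ then a x else 0) ≤
      B / (1 - q) * (R : ℝ) ^ (-α) + ∑' x : Site 3, (if 2 ^ J * (R : ℝ) < ‖x‖ then a x else 0) := by
    intro J
    rw [tsum_tail_eq_sum_shells ha hRpos.le J]
    gcongr
    calc ∑ j ∈ Finset.range J,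
          ∑' x : Site 3, (if 2 ^ j * (R : ℝ) < ‖x‖ ∧ ‖x‖ ≤ 2 * (2 ^ j * (R : ℝ)) then a x else 0)
        ≤ ∑ j ∈ Finset.range J, B * (R : ℝ) ^ (-α) * q ^ j := Finset.sum_le_sum fun j _ => hsh j
      _ = B * (R : ℝ) ^ (-α) * ∑ j ∈ Finset.range J, q ^ j := by rw [Finset.mul_sum]
      _ ≤ B * (R : ℝ) ^ (-α) * (1 - q)⁻¹ := by
          gcongr
          have := geom_sum_Ico_le_of_lt_one (m := 0) (n := J) hq0 hq1
          rwa [← Finset.range_eq_Ico, pow_zero, one_div] at this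
      _ = B / (1 - q) * (R : ℝ) ^ (-α) := by ring
  -- the limit `J → ∞`
  have hlim : Tendsto (fun J : ℕ => ∑' x : Site 3, (if 2 ^ J * (R : ℝ) < ‖x‖ then a x else 0))
      atTop (𝓝 0) :=
    tendsto_tsum_tail_zero ha
      ((tendsto_pow_atTop_atTop_of_one_lt (by norm_num : (1 : ℝ) < 2)).atTop_mul_const hRpos)
  have := ge_of_tendsto' (tendsto_const_nhds.add hlim) hJ
  rwa [add_zero] at this

/-! ### The tail bound from vague boundedness -/

/-- **Registered auxiliary stub `stub_slabFunctionalLimit_auxTail`** (sub-goal of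
`stub_slabFunctionalLimit`): for a summable `a : ℤ³ → ℝ`, nonnegative off the origin, whose rescaled
sums `R^α Σ_x a(x) f(x/R)` converge for every continuous compactly supported `f` vanishing near `0`,
the tails satisfy `Σ_{‖x‖ > R} a(x) ≤ C R^{-α}` for all `R ∈ ℕ`, `R ≥ 1`.  Proof: the shell test
function `f₀(u) = max(0, min(1, 2‖u‖ - 1, 3 - ‖u‖))` is `≥ 1` on `1 ≤ ‖u‖ ≤ 2`, so boundedness of the
convergent sequence `R^α Σ_x a(x) f₀(x/R)` bounds the dyadic shells; then `tsum_tail_le_of_shell_le`.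
[folklore] -/
theorem stub_slabFunctionalLimit_auxTail : ∀ (a : Site 3 → ℝ) (α : ℝ) (Ψ : (Fin 3 → ℝ) → ℝ), 0 < α → (∀ x : Site 3, x ≠ 0 → 0 ≤ a x) → Summable a → (∀ f : (Fin 3 → ℝ) → ℝ, Continuous f → HasCompactSupport f → (0 : Fin 3 → ℝ) ∉ tsupport f → Filter.Tendsto (fun R : ℕ => (R : ℝ) ^ α * ∑' x : Site 3, a x * f (fun j => (x j : ℝ) / (R : ℝ))) Filter.atTop (nhds (∫ y : Fin 3 → ℝ, f y * Ψ y))) → ∃ C : ℝ, ∀ R : ℕ, 1 ≤ R → ∑' x : Site 3, (if (R : ℝ) < ‖x‖ then a x else 0) ≤ C * (R : ℝ) ^ (-α) := by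
  intro a α Ψ hα ha0 ha hlim
  -- the shell test function
  set f₀ : (Fin 3 → ℝ) → ℝ := fun u => max 0 (min (min 1 (2 * ‖u‖ - 1)) (3 - ‖u‖)) with hf₀
  have hf₀c : Continuous f₀ :=
    continuous_const.max (((continuous_const.min (by fun_prop)).min (by fun_prop)))
  have hf₀nn : ∀ u, 0 ≤ f₀ u := fun u => le_max_left _ _
  have hf₀zero : ∀ u : Fin 3 → ℝ, ‖u‖ < 1 / 2 → f₀ u = 0 := fun u hu =>
    max_eq_left ((min_le_left _ _).trans ((min_le_right _ _).trans (by linarith)))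
  have hf₀zero' : ∀ u : Fin 3 → ℝ, 3 ≤ ‖u‖ → f₀ u = 0 := fun u hu =>
    max_eq_left ((min_le_right _ _).trans (by linarith))
  have hf₀one : ∀ u : Fin 3 → ℝ, 1 ≤ ‖u‖ → ‖u‖ ≤ 2 → 1 ≤ f₀ u := fun u h1 h2 =>
    le_max_of_le_right (le_min (le_min le_rfl (by linarith)) (by linarith))
  have hf₀supp : HasCompactSupport f₀ := by
    refine HasCompactSupport.intro (isCompact_closedBall (0 : Fin 3 → ℝ) 3) fun u hu => hf₀zero' u ?_
    rw [Metric.mem_closedBall, dist_zero_right, not_le] at hu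
    exact hu.le
  have hf₀t : (0 : Fin 3 → ℝ) ∉ tsupport f₀ := by
    rw [notMem_tsupport_iff_eventuallyEq]
    filter_upwards [Metric.ball_mem_nhds (0 : Fin 3 → ℝ) (by norm_num : (0 : ℝ) < 1 / 2)] with u hu
    rw [Metric.mem_ball, dist_zero_right] at hu
    exact hf₀zero u hu
  obtain ⟨M, hM⟩ := hf₀c.bounded_above_of_compact_support hf₀supp
  -- boundedness of the convergent sequence
  obtain ⟨B₀, hB₀⟩ := (hlim f₀ hf₀c hf₀supp hf₀t).bddAbove_range
  have hb : ∀ R : ℕ, (R : ℝ) ^ α * ∑' x : Site 3, a x * f₀ (fun j => (x j : ℝ) / (R : ℝ)) ≤ B₀ :=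
    fun R => hB₀ ⟨R, rfl⟩
  -- the shell bound
  have hshell : ∀ R : ℕ, 1 ≤ R → ∑' x : Site 3, (if (R : ℝ) < ‖x‖ ∧ ‖x‖ ≤ 2 * (R : ℝ) then a x else 0)
      ≤ max B₀ 0 * (R : ℝ) ^ (-α) := by
    intro R hR
    have hRpos : (0 : ℝ) < R := by exact_mod_cast hR
    have hsum : Summable fun x : Site 3 => a x * f₀ (fun j => (x j : ℝ) / (R : ℝ)) :=
      Summable.of_norm_bounded (ha.norm.mul_right M) fun x => by
        rw [norm_mul]
        exact mul_le_mul_of_nonneg_left (hM _) (norm_nonneg _)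
    have h1 : ∑' x : Site 3, (if (R : ℝ) < ‖x‖ ∧ ‖x‖ ≤ 2 * (R : ℝ) then a x else 0)
        ≤ ∑' x : Site 3, a x * f₀ (fun j => (x j : ℝ) / (R : ℝ)) := by
      refine Summable.tsum_le_tsum (fun x => ?_) (summable_ite_of_summable ha _) hsum
      have hnorm := norm_intCast_div_eq x hRpos
      split_ifs with hx
      · have hx0 : x ≠ 0 := by
          rintro rfl
          rw [norm_zero] at hx
          linarith [hx.1]
        refine le_mul_of_one_le_right (ha0 x hx0) (hf₀one _ ?_ ?_)
        · rw [hnorm, le_div_iff₀ hRpos]; linarith [hx.1]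
        · rw [hnorm, div_le_iff₀ hRpos]; linarith [hx.2]
      · by_cases hx0 : x = 0
        · subst hx0
          rw [hf₀zero _ (by rw [hnorm, norm_zero, zero_div]; norm_num), mul_zero]
        · exact mul_nonneg (ha0 x hx0) (hf₀nn _)
    have h2 : ∑' x : Site 3, a x * f₀ (fun j => (x j : ℝ) / (R : ℝ)) ≤ B₀ * (R : ℝ) ^ (-α) := by
      rw [Real.rpow_neg hRpos.le, ← div_eq_mul_inv, le_div_iff₀ (Real.rpow_pos_of_pos hRpos α),
        mul_comm]
      exact hb R
    calc _ ≤ _ := h1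
      _ ≤ B₀ * (R : ℝ) ^ (-α) := h2
      _ ≤ max B₀ 0 * (R : ℝ) ^ (-α) :=
          mul_le_mul_of_nonneg_right (le_max_left _ _) (Real.rpow_nonneg hRpos.le _)
  exact ⟨max B₀ 0 / (1 - 2 ^ (-α)), fun R hR =>
    tsum_tail_le_of_shell_le ha hα (le_max_right _ _) hshell R hR⟩

/-! ### Slab regrouping -/

/-- A slab point reflected in the slab direction: `ins_i(-n, y) = -ins_i(n, -y)`. [folklore] -/
theorem insertNth_neg_eq_neg (i : Fin 3) (n : ℤ) (y : Fin 2 → ℤ) :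
    (Fin.insertNth i (-n) y : Site 3) = -(Fin.insertNth i n (-y) : Site 3) := by
  ext j
  refine Fin.succAboveCases i ?_ (fun j' => ?_) j
  · simp [Fin.insertNth_apply_same]
  · simp [Fin.insertNth_apply_succAbove]

/-- **Slab regrouping.** For an even summable `a : ℤ³ → ℝ` and an even bounded weight `h : ℤ → ℝ`
with `h 0 = 0`: `Σ_x a(x) h(x_i) = 2 Σ_{n ∈ ℕ} S⁽ⁱ⁾(n) h(n)`, `S⁽ⁱ⁾(n) = Σ_{y ∈ ℤ²} a(ins_i(n, y))`
(regroup `ℤ³ = ℤ × ℤ²` along the coordinate `i`, pair `n` with `-n`). [folklore] -/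
theorem tsum_mul_eq_two_mul_tsum_slab {a : Site 3 → ℝ} (ha : Summable a)
    (haev : ∀ x : Site 3, a (-x) = a x) (i : Fin 3) {h : ℤ → ℝ} {M : ℝ} (hM : ∀ n, |h n| ≤ M)
    (hev : ∀ n, h (-n) = h n) (h0 : h 0 = 0) :
    ∑' x : Site 3, a x * h (x i) =
      2 * ∑' n : ℕ, (∑' y : Fin 2 → ℤ, a (Fin.insertNth i (n : ℤ) y : Site 3)) * h n := by
  set e : ℤ × (Fin 2 → ℤ) ≃ Site 3 := Fin.insertNthEquiv (fun _ => ℤ) i with he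
  have he_apply : ∀ p : ℤ × (Fin 2 → ℤ), e p = Fin.insertNth i p.1 p.2 := fun p => rfl
  -- summability
  have hF : Summable fun x : Site 3 => a x * h (x i) :=
    Summable.of_norm_bounded (ha.norm.mul_right M) fun x => by
      rw [norm_mul]
      exact mul_le_mul_of_nonneg_left ((Real.norm_eq_abs _).trans_le (hM _)) (norm_nonneg _)
  have hF2 : Summable fun p : ℤ × (Fin 2 → ℤ) => a (Fin.insertNth i p.1 p.2) * h p.1 := by
    have := (e.summable_iff (f := fun x : Site 3 => a x * h (x i))).2 hF
    simpa only [Function.comp_def, he_apply, Fin.insertNth_apply_same] using this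
  -- regroup along the coordinate `i`
  have h1 : ∑' x : Site 3, a x * h (x i) =
      ∑' p : ℤ × (Fin 2 → ℤ), a (Fin.insertNth i p.1 p.2) * h p.1 := by
    refine ((e.tsum_eq fun x : Site 3 => a x * h (x i)).symm.trans (tsum_congr fun p => ?_))
    simp only [he_apply, Fin.insertNth_apply_same]
  have h2 : ∑' p : ℤ × (Fin 2 → ℤ), a (Fin.insertNth i p.1 p.2) * h p.1 =
      ∑' n : ℤ, (∑' y : Fin 2 → ℤ, a (Fin.insertNth i n y)) * h n := by
    rw [hF2.tsum_prod]
    refine tsum_congr fun n => ?_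
    show ∑' y : Fin 2 → ℤ, a (Fin.insertNth i n y) * h n = _
    exact tsum_mul_right
  -- evenness of the slab sums
  have hSev : ∀ n : ℤ, ∑' y : Fin 2 → ℤ, a (Fin.insertNth i (-n) y) =
      ∑' y : Fin 2 → ℤ, a (Fin.insertNth i n y) := by
    intro n
    calc ∑' y : Fin 2 → ℤ, a (Fin.insertNth i (-n) y)
        = ∑' y : Fin 2 → ℤ, a (Fin.insertNth i n (-y)) :=
          tsum_congr fun y => by rw [insertNth_neg_eq_neg, haev]
      _ = ∑' y : Fin 2 → ℤ, a (Fin.insertNth i n y) :=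
          (Equiv.neg (Fin 2 → ℤ)).tsum_eq (fun y => a (Fin.insertNth i n y))
  -- the sum over `ℤ` is twice the sum over `ℕ`
  have hSs : Summable fun n : ℤ => (∑' y : Fin 2 → ℤ, a (Fin.insertNth i n y)) * h n := by
    refine hF2.prod.congr fun n => ?_
    show ∑' y : Fin 2 → ℤ, a (Fin.insertNth i n y) * h n = _
    exact tsum_mul_right
  have hZ := hSs.hasSum.nat_add_neg
  simp only [hSev, hev, h0, mul_zero, add_zero] at hZ
  rw [h1, h2, ← hZ.tsum_eq, ← tsum_mul_left]
  exact tsum_congr fun n => by ring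

end Summit.CriticalPhenomena.Ising3DConformalLimit.Cruxes.DirectCorrelationStableTail.SelfEnergyPickInversion

end
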